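import Mathlib.Geometry.Manifold.Instances.Sphere
import Mathlib.Geometry.Manifold.Diffeomorph
import Literature.Topology.FourManifolds.CappellShaneson
import Literature.Topology.FourManifolds.CappellShanesonGompfReduction
import HarnessLib
import Summits.SmoothPoincare4.SmoothPoincare4.Theorems.CappellShanesonSpheresStandard

/-!
# Barrier (SmoothPoincare4): the worked-out Cappell–Shaneson spheres are standard (Akbulut, Gompf)

Barrier catalogue `Literature/Barriers/SmoothPoincare4/` (D-0021), entry for the technique class
**"refute `SmoothPoincare4` with a Cappell–Shaneson homotopy sphere"** — surgery on the section
circle of the mapping torus of `A ∈ SL(3, ℤ)`, `det (A - I) = ±1`, acting on `T³`, either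
framing (`Literature.IsCappellShanesonSphereOf A X`) — "the best-known, and historically the most
promising, family of potential counterexamples" (Gompf 2010, §1), restricted to the matrices for
which the literature has decided the question: the standard family `Aₘ` (Akbulut 2010; Gompf 2010,
Examples 3.1(a)) and Gompf's trace/entry conditions (2010, Thms. 3.2, 3.4, Cor. 3.5).

## What is printed

* Gompf 2010, §1: "These were indexed by an infinite family of matrices, together with a `ℤ/2`
  choice of a framing. ... Akbulut [A] found a simple proof that these diagrams all represent
  diffeomorphic manifolds, so they are `S⁴` by previous results. In the present paper, we show
  that a strictly larger family is `S⁴`. The work is still in progress, and may ultimately show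
  that all Cappell-Shaneson homotopy spheres are `S⁴`". Akbulut 2010, Thm. 1: "`Σₘ` is
  diffeomorphic to `S⁴`, for each `m ∈ ℤ`" (the `Σₘ` being "the 2-fold covers of homotopy
  `ℝℙ⁴`'s" of Cappell–Shaneson, §0). Tree: named fact
  `Literature.Topology.FourManifolds.nonempty_diffeomorph_sphere_four_of_isCappellShanesonSphereOf` (all `m`, both
  framings), with Gompf's reduction to `A₀` proved in `CappellShanesonGompfReduction.lean`.
* Gompf 2010, Thm. 3.2: "Suppose the Cappell-Shaneson matrix `A` can be conjugated to standard
  form with `tr(A) ≡ r` mod `d` for some `r ∈ ℤ` such that `-6 ≤ r ≤ 9` or there is only one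
  conjugacy class with trace `r` (e.g. `r = 11`). Then both homotopy spheres associated to `A` are
  diffeomorphic to `S⁴`. In particular, this holds whenever `|d| < 17`." (standard form:
  `A = !![0, a, b; 0, c, d; 1, e, f]`, §3; "Cappell-Shaneson matrix" := `det (A - I) = +1`, §3,
  the sign being normalised by `A ↦ A⁻¹`); Lemma 3.3: "`d` and either `a` or `e` are odd";
  Thm. 3.4 (`c ≡ r` mod `d` or mod `a + ce`, `-3 ≤ r ≤ 4`); Cor. 3.5: "If a Cappell-Shaneson
  homotopy sphere is not diffeomorphic to `S⁴`, then its matrix, in standard form, must have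
  `|d| ≥ 17`, `|a + ce| ≥ 9`, `|c - 1/2| > 4` and `|c + f - 3/2| > 8`"; and: "The author does not
  presently know whether they cover all Cappell-Shaneson homotopy spheres."
* Freedman–Gompf–Morrison–Walker 2010 / Nakamura 2023, §1.1: the `s`-invariant attack on the
  Cappell–Shaneson spheres `Σₙ` was overtaken "only six days after" by Akbulut's proof that "all
  `Σₙ` are standard", so that "we are left with a dearth of homotopy spheres".

## How it is rendered here (relative to the tree's named facts, D-0014)

* `ExoticCappellShanesonSphere 𝒜` — the technique class, explicit and parametrised by the set
  `𝒜 ⊆ SL(3, ℤ)` of matrices used: some Cappell–Shaneson sphere of some `A ∈ 𝒜` is not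
  diffeomorphic to `S⁴`. For `𝒜 = univ` this is `¬ Literature.SPC4.CappellShanesonSpheresStandard`
  (`exoticCappellShanesonSphere_univ_iff`), which is OPEN.
* `CappellShanesonFamilyBarrier := ¬ ExoticCappellShanesonSphere (range cappellShanesonMatrix)`
  — PROVED (`cappellShanesonFamilyBarrier_of_akbulut_gompf`) from the tree fact.
* `gompf2010_theorem32_d` — named fact (Thm. 3.2, last sentence), over the tree's
  `Literature.Topology.FourManifolds.IsGompfStandardForm` and the matrix entries; and the barrier
  for Gompf's class `CappellShanesonSmallEntryBarrier` PROVED from it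
  (`cappellShanesonSmallEntryBarrier_of_gompf`). Cor. 3.5 is NOT a named fact of this file (it was
  one, `gompf2010_corollary35`, until its D-0026/D-0027 review of 2026-08-15 merged it back: as an
  obligation it is an assembly node over the two live geometric leaves
  `Literature.Topology.FourManifolds.gompf2010_framedTwist` and
  `Literature.Topology.FourManifolds.akbulutKirby1979_linearStraightening`, all glue being proved
  in the sibling proof files); its statement — for `A` in standard form with `det (A - 1) = 1`
  having a Cappell–Shaneson sphere `X ≇ S⁴`: `17 ≤ |d|`, `9 ≤ |a + ce|`, `8 < |2c - 1|`,
  `16 < |2(c + f) - 3|` — is the conclusion of the proved theorems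
  `gompf2010_corollary35_of_leaves` (`CappellShanesonFamilyStandardProofs.lean`, Part II) and
  `gompf2010_corollary35_of_framedTwist_AK` (`CappellShanesonFamilyStandardHolds.lean`), and is
  quoted here verbatim as the hypothesis of `cappellShanesonSmallEntryBarrier_of_corollary35`.

## References

[GompfAGT2010] [Akbulut2010] [CappellShaneson1976] [AkbulutKirby1985] [Gompf1991]
[FreedmanGompfMorrisonWalker2010] [Nakamura2023]
-/

noncomputable section

open scoped Manifold ContDiff
open Set

namespace Literature.Barriers.SmoothPoincare4

universe u

/-- Local notation: `𝔼 n` is the model Euclidean space `EuclideanSpace ℝ (Fin n)`. -/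
local notation "𝔼 " n:arg => EuclideanSpace ℝ (Fin n)

/-- Local notation: `𝕊 n` is the unit sphere in `EuclideanSpace ℝ (Fin (n + 1))`, the standard
`n`-sphere with its Mathlib manifold structure. -/
local notation "𝕊 " n:arg => (Metric.sphere (0 : EuclideanSpace ℝ (Fin (n + 1))) 1)

/-! ### The technique class -/

/-- **Technique class: an exotic Cappell–Shaneson sphere from a matrix in `𝒜`.** For a set
`𝒜 ⊆ SL(3, ℤ)` of matrices: some `A ∈ 𝒜` and some closed smooth 4-manifold `X` (Hausdorff,
second countable, compact, `C^∞` on `ℝ⁴`, in `Type`) which is a Cappell–Shaneson sphere of `A`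
(`Literature.IsCappellShanesonSphereOf A X`: `det (A - 1) = ±1`, mapping torus of `A` on `T³` surgered
along the section circle, EITHER framing) with `X` not diffeomorphic to `S⁴`. Cappell–Shaneson
spheres are "the best-known, and historically the most promising, family of potential
counterexamples" (Gompf 2010, §1). [cite: GompfAGT2010, §1] [cite: CappellShaneson1976, §2] -/
def ExoticCappellShanesonSphere (𝒜 : Set (Matrix.SpecialLinearGroup (Fin 3) ℤ)) : Prop :=
  ∃ A ∈ 𝒜, ∃ (X : Type) (_ : TopologicalSpace X) (_ : T2Space X) (_ : SecondCountableTopology X)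
    (_ : ChartedSpace (𝔼 4) X) (_ : IsManifold (𝓡 4) ∞ X) (_ : CompactSpace X),
    Literature.Topology.FourManifolds.IsCappellShanesonSphereOf A X ∧ IsEmpty (X ≃ₘ⟮𝓡 4, 𝓡 4⟯ (𝕊 4))

/-- The class is monotone in the set of matrices. [folklore] -/
theorem ExoticCappellShanesonSphere.mono {𝒜 ℬ : Set (Matrix.SpecialLinearGroup (Fin 3) ℤ)}
    (h : ExoticCappellShanesonSphere 𝒜) (hle : 𝒜 ⊆ ℬ) : ExoticCappellShanesonSphere ℬ := by
  obtain ⟨A, hA, rest⟩ := h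
  exact ⟨A, hle hA, rest⟩

/-- With ALL matrices allowed, the technique class is exactly the negation of the tree's open
statement `Literature.Topology.FourManifolds.CappellShanesonSpheresStandard` (spc4.S18: every Cappell–Shaneson sphere is
`≅ S⁴`). [cite: GompfAGT2010, §1] -/
theorem exoticCappellShanesonSphere_univ_iff :
    ExoticCappellShanesonSphere univ ↔ ¬ Summit.SmoothPoincare4.SmoothPoincare4.CappellShanesonSpheresStandard := by
  constructor
  · rintro ⟨A, -, X, _, _, _, _, _, _, hX, hE⟩ h
    obtain ⟨e⟩ := h X ⟨A, hX⟩
    exact hE.false e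
  · intro h
    by_contra hne
    refine h fun X _ _ _ _ _ _ hX => ?_
    obtain ⟨A, hA⟩ := hX
    by_contra hno
    exact hne ⟨A, mem_univ A, X, inferInstance, inferInstance, inferInstance, inferInstance,
      inferInstance, inferInstance, hA, ⟨fun e => hno ⟨e⟩⟩⟩

/-! ### The standard family `Aₘ`: barrier proved from the tree fact -/

/-- **Barrier (named statement): no Cappell–Shaneson sphere of the standard family `Aₘ`
(either framing) is exotic** — `¬ ExoticCappellShanesonSphere (range cappellShanesonMatrix)`,
`Aₘ = !![0, 1, 0; 0, 1, 1; 1, 0, m + 1]`. PROVED below from the tree's named fact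
`Literature.Topology.FourManifolds.nonempty_diffeomorph_sphere_four_of_isCappellShanesonSphereOf` (Akbulut 2010, Thm. 1;
Gompf 2010, Examples 3.1(a) with Thm. 4.3 and Akbulut–Kirby 1979), hypothesis `hAG`.

BARRIER (D-0021), one line per key:
* technique_class: refuting `SmoothPoincare4` by a Cappell–Shaneson homotopy sphere [cite: CappellShaneson1976, §2] — formally `ExoticCappellShanesonSphere 𝒜` for the matrix sets `𝒜` on which the literature has decided: the family `Aₘ`, both framings [cite: Akbulut2010, Thm. 1] [cite: GompfAGT2010, Examples 3.1(a)], and Gompf's classes (standard form with `|d| < 17`, or the trace/entry congruences) [cite: GompfAGT2010, Thm. 3.2, Thm. 3.4].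
* blocks: proving `Literature.Topology.FourManifolds.ExistsExoticFourSphere` (`¬ SmoothPoincare4`) with these candidates — including the Akbulut–Kirby sphere advertised as "a potential smooth counterexample in dimension 4 to the Poincaré conjecture" [cite: AkbulutKirby1985, title and §1] and the `s`-invariant attack of Freedman–Gompf–Morrison–Walker on the `Σₙ` [cite: Nakamura2023, §1.1]; what remains of the class is `ExoticCappellShanesonSphere` for matrices whose every standard form has `|d| ≥ 17`, `|a + ce| ≥ 9`, `|c - 1/2| > 4`, `|c + f - 3/2| > 8` [cite: GompfAGT2010, Cor. 3.5].
* because: the pair of diffeomorphism types attached to `A` depends only on the `GL(3, ℤ)`-conjugacy class and is unchanged under `A ↦ Δᵏ A`, `A ↦ A Δᵏ` for `A` in standard form (log transforms of multiplicity one in a fishtail neighbourhood) [cite: GompfAGT2010, Thm. 2.1 and §3]; this moves `Aₘ` to trace `2`, where the conjugacy class is unique, i.e. to `A₀` [cite: GompfAGT2010, Examples 3.1(a)], whose two spheres are diffeomorphic to each other [cite: GompfAGT2010, Thm. 4.3] and to `S⁴` by a cancelling handle diagram [cite: GompfAGT2010, §1 ([AK1])]; independently, Akbulut's handle-slide identifies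 all `Σₘ` with `Σ₀` [cite: Akbulut2010, Thm. 1].
* evasions_known: Cappell–Shaneson matrices not covered by Thms. 3.2/3.4 — "The author does not presently know whether they cover all Cappell-Shaneson homotopy spheres" [cite: GompfAGT2010, §3 (after Cor. 3.5)]; other constructions of homotopy 4-spheres (Gluck twists, zero-surgery homeomorphisms) are untouched by this entry [cite: Nakamura2023, §1.1].
* scope_caveats: (a) nothing here bears on Cappell–Shaneson matrices outside the cited classes: `Literature.Topology.FourManifolds.CappellShanesonSpheresStandard` (all `A`) is open, and `ExoticCappellShanesonSphere univ` is exactly its negation (`exoticCappellShanesonSphere_univ_iff`) [cite: GompfAGT2010, §1 and §3]; (b) Gompf's standard form is not unique ("none of the entries `a`-`d`, `f` are invariant"), so `gompf2010_theorem32_d` and the statement of Cor. 3.5 (hypothesis of `cappellShanesonSmallEntryBarrier_of_corollary35`) are stated per standard-form representative with `det (A - 1) = +1` (Gompf's normalisation; the tree's `IsCappellShanesonSphereOf` also allows `-1`, reached by `A ↦ A⁻¹`) [cite: GompfAGT2010, §3]; (c) the trace-congruence parts of Thms. 3.2/3.4 (which need the Aitchison–Rubinstein count of conjugacy classes) are not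 rendered, only the `|d| < 17` clause and Cor. 3.5.
* status: established (theorem: `cappellShanesonFamilyBarrier_of_akbulut_gompf` from the tree fact; `cappellShanesonSmallEntryBarrier_of_gompf` from the vendored Thm. 3.2) [cite: Akbulut2010, Thm. 1] [cite: GompfAGT2010, Examples 3.1(a), Thm. 3.2]

[cite: Akbulut2010, Thm. 1] [cite: GompfAGT2010, Examples 3.1(a) and Thm. 3.2] -/
def CappellShanesonFamilyBarrier : Prop :=
  ¬ ExoticCappellShanesonSphere (range Literature.Topology.FourManifolds.cappellShanesonMatrix)

/-- **`CappellShanesonFamilyBarrier` follows from Akbulut–Gompf** as vendored in the tree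
(`Literature.SPC4.nonempty_diffeomorph_sphere_four_of_isCappellShanesonSphereOf X : Prop`, for every
closed smooth `X`, taken as the hypothesis `hAG`, D-0014). [cite: Akbulut2010, Thm. 1] [cite: GompfAGT2010, Examples 3.1(a)] -/
theorem cappellShanesonFamilyBarrier_of_akbulut_gompf
    (hAG : ∀ (X : Type) [TopologicalSpace X] [T2Space X] [SecondCountableTopology X]
      [ChartedSpace (𝔼 4) X] [IsManifold (𝓡 4) ∞ X] [CompactSpace X],
      Literature.Topology.FourManifolds.nonempty_diffeomorph_sphere_four_of_isCappellShanesonSphereOf X) :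
    CappellShanesonFamilyBarrier := by
  rintro ⟨A, ⟨m, rfl⟩, X, _, _, _, _, _, _, hX, hE⟩
  obtain ⟨e⟩ := hAG X m hX
  exact hE.false e

/-! ### Gompf's classes (Thm. 3.2, Cor. 3.5) -/

/-- **Gompf 2010, Thm. 3.2, last sentence (named fact).** Let `A ∈ SL(3, ℤ)` be a
Cappell–Shaneson matrix in Gompf's sense (`det (A - I) = 1`) in standard form
`A = !![0, a, b; 0, c, d; 1, e, f]` (`Literature.IsGompfStandardForm A`) with `|d| < 17`, `d = A₁₂`.
Then every Cappell–Shaneson sphere of `A` (either framing) is diffeomorphic to `S⁴` ("both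
homotopy spheres associated to `A` are diffeomorphic to `S⁴`. In particular, this holds whenever
`|d| < 17`"). Users take `(h : gompf2010_theorem32_d)`. [cite: GompfAGT2010, Thm. 3.2] -/
def gompf2010_theorem32_d : Prop :=
  ∀ (A : Matrix.SpecialLinearGroup (Fin 3) ℤ), Literature.Topology.FourManifolds.IsGompfStandardForm A →
    ((A : Matrix (Fin 3) (Fin 3) ℤ) - 1).det = 1 → |(A : Matrix (Fin 3) (Fin 3) ℤ) 1 2| < 17 →
    ∀ (X : Type u) [TopologicalSpace X] [T2Space X] [SecondCountableTopology X]
      [ChartedSpace (𝔼 4) X] [IsManifold (𝓡 4) ∞ X] [CompactSpace X],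
      Literature.Topology.FourManifolds.IsCappellShanesonSphereOf A X → Nonempty (X ≃ₘ⟮𝓡 4, 𝓡 4⟯ (𝕊 4))

/-- Gompf's class of matrices settled by Thm. 3.2 (last sentence): standard form,
`det (A - 1) = 1`, `|d| < 17`. [cite: GompfAGT2010, Thm. 3.2] -/
def gompfSmallEntryClass : Set (Matrix.SpecialLinearGroup (Fin 3) ℤ) :=
  {A | Literature.Topology.FourManifolds.IsGompfStandardForm A ∧ ((A : Matrix (Fin 3) (Fin 3) ℤ) - 1).det = 1 ∧
    |(A : Matrix (Fin 3) (Fin 3) ℤ) 1 2| < 17}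

/-- The standard family lies in Gompf's class: `Aₘ` is in standard form with `d = 1` and
`det (Aₘ - 1) = 1`. [cite: GompfAGT2010, Examples 3.1(a)] -/
theorem cappellShanesonMatrix_mem_gompfSmallEntryClass (m : ℤ) :
    Literature.Topology.FourManifolds.cappellShanesonMatrix m ∈ gompfSmallEntryClass := by
  refine ⟨Literature.Topology.FourManifolds.isGompfStandardForm_cappellShanesonMatrix m, ?_, ?_⟩
  · simp [Matrix.det_fin_three]
  · simp

/-- **Barrier for Gompf's class (named statement)**: no Cappell–Shaneson sphere of a matrix in
standard form with `det (A - 1) = 1` and `|d| < 17` is exotic. PROVED below from the vendored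
Thm. 3.2 (`cappellShanesonSmallEntryBarrier_of_gompf`); it contains the family barrier
(`cappellShanesonFamilyBarrier_of_smallEntry`). [cite: GompfAGT2010, Thm. 3.2] -/
def CappellShanesonSmallEntryBarrier : Prop :=
  ¬ ExoticCappellShanesonSphere gompfSmallEntryClass

/-- `CappellShanesonSmallEntryBarrier` from Gompf's Thm. 3.2 (hypothesis `hG`, D-0014).
[cite: GompfAGT2010, Thm. 3.2] -/
theorem cappellShanesonSmallEntryBarrier_of_gompf (hG : gompf2010_theorem32_d.{0}) :
    CappellShanesonSmallEntryBarrier := by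
  rintro ⟨A, ⟨hsf, hdet, hd⟩, X, _, _, _, _, _, _, hX, hE⟩
  obtain ⟨e⟩ := hG A hsf hdet hd X hX
  exact hE.false e

/-- The small-entry barrier contains the family barrier (monotonicity along
`range cappellShanesonMatrix ⊆ gompfSmallEntryClass`). [cite: GompfAGT2010, Examples 3.1(a)] -/
theorem cappellShanesonFamilyBarrier_of_smallEntry (h : CappellShanesonSmallEntryBarrier) :
    CappellShanesonFamilyBarrier := by
  intro hex
  refine h (hex.mono ?_)
  rintro A ⟨m, rfl⟩
  exact cappellShanesonMatrix_mem_gompfSmallEntryClass m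

/-- **Gompf 2010, Cor. 3.5, read contrapositively on Gompf's class**: a matrix in standard form
with `det (A - 1) = 1` and `|d| < 17` carries no exotic Cappell–Shaneson sphere. The hypothesis
`hC` is Cor. 3.5 as printed — "If a Cappell-Shaneson homotopy sphere is not diffeomorphic to `S⁴`,
then its matrix, in standard form, must have `|d| ≥ 17`, `|a + ce| ≥ 9`, `|c - 1/2| > 4` and
`|c + f - 3/2| > 8`" — rendered for `A` with `det (A - I) = 1` in standard form
`!![0, a, b; 0, c, d; 1, e, f]` (entries `a = A₀₁`, `c = A₁₁`, `d = A₁₂`, `e = A₂₁`, `f = A₂₂`)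
having a Cappell–Shaneson sphere `X ≇ S⁴` (`X : Type`), the last two inequalities doubled to stay
in `ℤ` (`|2c - 1| > 8`, `|2(c + f) - 3| > 16`). This statement was the named fact
`gompf2010_corollary35` of this file until its D-0026/D-0027 review (2026-08-15) merged it back:
it is PROVED from the two live geometric leaves in the sibling proof files
(`gompf2010_corollary35_of_framedTwist_AK`, `CappellShanesonFamilyStandardHolds.lean`; from the
framing-free leaves, `gompf2010_corollary35_of_leaves`, `CappellShanesonFamilyStandardProofs.lean`),
whose conclusion, at `Type`, is exactly `hC`. [cite: GompfAGT2010, Cor. 3.5] -/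
theorem cappellShanesonSmallEntryBarrier_of_corollary35
    (hC : ∀ (A : Matrix.SpecialLinearGroup (Fin 3) ℤ),
      Literature.Topology.FourManifolds.IsGompfStandardForm A → ((A : Matrix (Fin 3) (Fin 3) ℤ) - 1).det = 1 →
      ∀ (X : Type) [TopologicalSpace X] [T2Space X] [SecondCountableTopology X]
        [ChartedSpace (𝔼 4) X] [IsManifold (𝓡 4) ∞ X] [CompactSpace X],
        Literature.Topology.FourManifolds.IsCappellShanesonSphereOf A X → IsEmpty (X ≃ₘ⟮𝓡 4, 𝓡 4⟯ (𝕊 4)) →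
          17 ≤ |(A : Matrix (Fin 3) (Fin 3) ℤ) 1 2| ∧
          9 ≤ |(A : Matrix (Fin 3) (Fin 3) ℤ) 0 1 +
                (A : Matrix (Fin 3) (Fin 3) ℤ) 1 1 * (A : Matrix (Fin 3) (Fin 3) ℤ) 2 1| ∧
          8 < |2 * (A : Matrix (Fin 3) (Fin 3) ℤ) 1 1 - 1| ∧
          16 < |2 * ((A : Matrix (Fin 3) (Fin 3) ℤ) 1 1 + (A : Matrix (Fin 3) (Fin 3) ℤ) 2 2) - 3|) :
    CappellShanesonSmallEntryBarrier := by
  rintro ⟨A, ⟨hsf, hdet, hd⟩, X, _, _, _, _, _, _, hX, hE⟩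
  have h17 := (hC A hsf hdet X hX hE).1
  omega

end Literature.Barriers.SmoothPoincare4

end
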